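import Mathlib.CategoryTheory.Comma.Over.Pullback
import Literature.AnabelianGeometry.SemiGraphs.SectionPullback

/-!
# The section pull-back computes `B(𝒢)_{/A} ⥲ B(𝒢′)`; invisible regluings give isomorphic objects
# ([SemiAnbd] §2, Def. 2.2 (i) p. 23, Cor. 2.7 (i) p. 30)

Mochizuki, *Semi-graphs of anabelioids*, Publ. RIMS **42** (2006) 221–322, §2: the finite étale covering
`φ : 𝒢′ → 𝒢` attached to `A` has "`B′ = B(𝒢)_{G′}`" (Def. 2.2 (i), p. 23) [cite: MochizukiSemiAnbd2006,
Def. 2.2(i) p.23]; Cor. 2.7 (i) (p. 30) compares sheets `ℋ″`, `g·ℋ″` of such objects.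

abc-iut cell, layer L3, FACT-LIST row F-1487 (`covering_subgraphComponents_doubleCosets` AS TYPED), seat
abc-iut-w4-d080 — brick (R4) of the tree-free «regluing invisibility» route
(`HOME/staging/w4/w4-d080-g7/F1487-MASSBALANCE-MEMO.md` §5), over (R1) `BObjReglue` and (R2)/(R3a)
`SectionPullback`.  For the GLOBAL clause in the form of abc-iut-L3-d3 / `TieLabels`
(`α : B(𝒢)_{/A} ⥤ B(𝒢′)` an equivalence with `e_B : φ^* ≅ (A × −) ⋙ α`, tautological section
`s = α(η_{𝟙_A}) ≫ e_B⁻¹_A : T → φ^*A`):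

* `Hom.sectionPullbackIsLimit` — the cellwise section pull-back IS a pullback `φ^*B ×_{φ^*A} T` in `B(𝒢′)`
  (limits of `B(𝒢′)` along the constituents);
* `Hom.overSquareIsLimit` — in `B(𝒢)_{/A}`, `(B → A) = (A × B → A) ×_{(A × A → A)} (A = A)` (unit of
  `forget ⊣ star` and the diagonal);
* `Hom.isoSectionPullback` — hence **`α(B → A) ≅ sectionPullback s (B → A)`**: the global equivalence is
  computed cell by cell from the section;
* `Hom.overIsoOfInvisibleReglue`, `Hom.isoReglueOfInvisible` — **an object over `A` reglued along
  twists invisible to the section (hypothesis of `Hom.sectionPullback_reglue`) is isomorphic, over `A`, to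
  the original** (`α` is fully faithful).  Consumers (memo §5 (R3b)/(R5)): a twist supported over a
  component `Q*` of `A_e` which is not an edge section label is invisible; regluing `Y ⊔ Y` crosswise along
  an essential such cell yields a connected object — contradiction — so essential cells are labels.

No new `Prop`; nothing here takes a side on [IUTchIII] Cor. 3.12.
-/

namespace Literature.AnabelianGeometry.SemiGraphs

open CategoryTheory CategoryTheory.Limits

-- objects of `B(𝒢′)` / `B(𝒢)_{/A}` occur below under several definitionally equal presentations
-- (`(F ⋙ G).obj X`, `(𝟭 _).obj X`, structure projections); let unification see through them.
set_option backward.isDefEq.respectTransparency false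

universe v₁ u₁ u

namespace SemiGraphOfAnabelioids

namespace Hom

variable {𝒢' 𝒢 : SemiGraphOfAnabelioids.{v₁, u₁, u}} (φ : Hom 𝒢' 𝒢)

/-! ### The section pull-back is a pullback in `B(𝒢′)` -/

section IsLimit

variable {A : 𝒢.BObj} {T : 𝒢'.BObj} (s : T ⟶ φ.pullbackFunctor.obj A) {B : 𝒢.BObj} (g : B ⟶ A)

/-- The morphism into the section pull-back induced by a commuting square, cell by cell.
[cite: MochizukiSemiAnbd2006, Def. 2.1 p.23] -/
noncomputable def sectionPullbackLift (c : PullbackCone (φ.pullbackFunctor.map g) s) :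
    c.pt ⟶ φ.sectionPullback s g where
  fS v' := pullback.lift (c.fst.fS v') (c.snd.fS v')
    (congrArg (fun f => BObj.Hom.fS f v') c.condition)
  fT e' := pullback.lift (c.fst.fT e') (c.snd.fT e')
    (congrArg (fun f => BObj.Hom.fT f e') c.condition)
  comm b' v' h' := by
    apply pullback.hom_ext
    · have h1 := φ.sectionPullback_ψ_hom_fst s g b' v' h'
      have h2 := c.fst.comm b' v' h'
      have h3 : (𝒢'.pull b' v' h').pullback.map (pullback.lift (c.fst.fS v') (c.snd.fS v')
            (congrArg (fun f => BObj.Hom.fS f v') c.condition)) ≫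
          (𝒢'.pull b' v' h').pullback.map (pullback.fst (φ.spLegS g v') (s.fS v')) =
          (𝒢'.pull b' v' h').pullback.map (c.fst.fS v') := by
        rw [← Functor.map_comp, pullback.lift_fst]
      have h4 : pullback.lift (c.fst.fT (𝒢'.graph.edgeOf b')) (c.snd.fT (𝒢'.graph.edgeOf b'))
            (congrArg (fun f => BObj.Hom.fT f (𝒢'.graph.edgeOf b')) c.condition) ≫
          pullback.fst (φ.spLegT g (𝒢'.graph.edgeOf b')) (s.fT (𝒢'.graph.edgeOf b')) =
          c.fst.fT (𝒢'.graph.edgeOf b') := pullback.lift_fst _ _ _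
      exact (Category.assoc _ _ _).trans <| (congrArg _ h1).trans <|
        ((Category.assoc _ _ _).symm.trans (congrArg (· ≫ _) h3)).trans <| h2.trans <|
        ((congrArg _ h4).symm.trans (Category.assoc _ _ _).symm)
    · have h1 := φ.sectionPullback_ψ_hom_snd s g b' v' h'
      have h2 := c.snd.comm b' v' h'
      have h3 : (𝒢'.pull b' v' h').pullback.map (pullback.lift (c.fst.fS v') (c.snd.fS v')
            (congrArg (fun f => BObj.Hom.fS f v') c.condition)) ≫
          (𝒢'.pull b' v' h').pullback.map (pullback.snd (φ.spLegS g v') (s.fS v')) =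
          (𝒢'.pull b' v' h').pullback.map (c.snd.fS v') := by
        rw [← Functor.map_comp, pullback.lift_snd]
      have h4 : pullback.lift (c.fst.fT (𝒢'.graph.edgeOf b')) (c.snd.fT (𝒢'.graph.edgeOf b'))
            (congrArg (fun f => BObj.Hom.fT f (𝒢'.graph.edgeOf b')) c.condition) ≫
          pullback.snd (φ.spLegT g (𝒢'.graph.edgeOf b')) (s.fT (𝒢'.graph.edgeOf b')) =
          c.snd.fT (𝒢'.graph.edgeOf b') := pullback.lift_snd _ _ _
      exact (Category.assoc _ _ _).trans <| (congrArg _ h1).trans <|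
        ((Category.assoc _ _ _).symm.trans (congrArg (· ≫ _) h3)).trans <| h2.trans <|
        ((congrArg _ h4).symm.trans (Category.assoc _ _ _).symm)

/-- **The section pull-back is a pullback** `φ^*B ×_{φ^*A} T` in `B(𝒢′)` (limits in `B(𝒢′)` are detected
constituent by constituent). [cite: MochizukiSemiAnbd2006, Def. 2.1 p.23] -/
noncomputable def sectionPullbackIsLimit :
    IsLimit (PullbackCone.mk (φ.sectionPullbackFst s g) (φ.sectionPullbackSnd s g)
      (φ.sectionPullback_condition s g)) :=
  PullbackCone.IsLimit.mk _ (fun c => φ.sectionPullbackLift s g c)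
    (fun c => by
      apply BObj.hom_ext
      · funext v'
        exact pullback.lift_fst _ _ _
      · funext e'
        exact pullback.lift_fst _ _ _)
    (fun c => by
      apply BObj.hom_ext
      · funext v'
        exact pullback.lift_snd _ _ _
      · funext e'
        exact pullback.lift_snd _ _ _)
    (fun c m h₁ h₂ => by
      apply BObj.hom_ext
      · funext v'
        apply pullback.hom_ext
        · exact (congrArg (fun f => BObj.Hom.fS f v') h₁).trans (pullback.lift_fst _ _ _).symm
        · exact (congrArg (fun f => BObj.Hom.fS f v') h₂).trans (pullback.lift_snd _ _ _).symm
      · funext e'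
        apply pullback.hom_ext
        · exact (congrArg (fun f => BObj.Hom.fT f e') h₁).trans (pullback.lift_fst _ _ _).symm
        · exact (congrArg (fun f => BObj.Hom.fT f e') h₂).trans (pullback.lift_snd _ _ _).symm)

end IsLimit

/-! ### The global equivalence is computed by the section pull-back -/

section Global

variable {A : 𝒢.BObj} [HasBinaryProducts 𝒢.BObj] (α : Over A ⥤ 𝒢'.BObj) [α.IsEquivalence]
  (eB : φ.pullbackFunctor ≅ Over.star A ⋙ α) {B : 𝒢.BObj} (g : B ⟶ A)

/-- The structure morphism `(B → A) → (A = A)` to the terminal object of `B(𝒢)_{/A}`.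
[cite: MochizukiSemiAnbd2006, Def. 2.2(i) p.23] -/
abbrev overToId : Over.mk g ⟶ Over.mk (𝟙 A) := Over.homMk g (Category.comp_id g)

/-- The square `(B → A) → (A × B → A) → (A × A → A)` = `(B → A) → (A = A) → (A × A → A)` in `B(𝒢)_{/A}`
(naturality of the unit `η` of `forget ⊣ star`). [cite: MochizukiSemiAnbd2006, Def. 2.2(i) p.23] -/
theorem overSquare_comm :
    (Over.forgetAdjStar A).unit.app (Over.mk g) ≫ (Over.forget A ⋙ Over.star A).map (overToId g) =
      overToId g ≫ (Over.forgetAdjStar A).unit.app (Over.mk (𝟙 A)) :=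
  ((Over.forgetAdjStar A).unit.naturality (overToId g)).symm

/-- **`(B → A)` is the pullback `(A × B → A) ×_{(A × A → A)} (A = A)` in `B(𝒢)_{/A}`**: a cone
`(W → A × B, W → (A = A))` corresponds under `forget ⊣ star` to a morphism `W → B` over `A`.
[cite: MochizukiSemiAnbd2006, Def. 2.2(i) p.23] -/
noncomputable def overSquareIsLimit :
    IsLimit (PullbackCone.mk ((Over.forgetAdjStar A).unit.app (Over.mk g)) (overToId g)
      (overSquare_comm g)) := by
  -- `η_V♭ = 𝟙`: the transpose of a unit component is the identity
  have eU : ∀ V : Over A, ((Over.forgetAdjStar A).homEquiv V ((Over.forget A).obj V)).symm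
      ((Over.forgetAdjStar A).unit.app V) = 𝟙 _ := fun V =>
    (Equiv.symm_apply_eq _).mpr
      (((Over.forgetAdjStar A).homEquiv_unit V ((Over.forget A).obj V) (𝟙 _)).trans
        ((congrArg _ ((Over.star A).map_id _)).trans (Category.comp_id _))).symm
  -- transpose `c₁♭ : W → B` of the first leg of a cone, and the identities it satisfies
  have key : ∀ c : PullbackCone ((Over.forget A ⋙ Over.star A).map (overToId g))
      ((Over.forgetAdjStar A).unit.app (Over.mk (𝟙 A))),
      ((Over.forgetAdjStar A).homEquiv c.pt B).symm c.fst ≫ g = (Over.forget A).map c.snd ∧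
        (Over.forget A).map c.snd = c.pt.hom := by
    intro c
    refine ⟨?_, (Category.comp_id _).symm.trans (Over.w c.snd)⟩
    have eL := (Over.forgetAdjStar A).homEquiv_naturality_right_symm c.fst
      ((Over.forget A).map (overToId g))
    have eR := (Over.forgetAdjStar A).homEquiv_naturality_left_symm c.snd
      ((Over.forgetAdjStar A).unit.app (Over.mk (𝟙 A)))
    have hc := congrArg ((Over.forgetAdjStar A).homEquiv c.pt A).symm c.condition
    exact eL.symm.trans <| hc.trans <| eR.trans <| (congrArg _ (eU _)).trans (Category.comp_id _)
  refine PullbackCone.IsLimit.mk _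
    (fun c => Over.homMk (((Over.forgetAdjStar A).homEquiv c.pt B).symm c.fst)
      (show ((Over.forgetAdjStar A).homEquiv c.pt B).symm c.fst ≫ g = c.pt.hom from
        (key c).1.trans (key c).2)) ?_ ?_ ?_
  · intro c
    apply ((Over.forgetAdjStar A).homEquiv c.pt B).symm.injective
    exact ((Over.forgetAdjStar A).homEquiv_naturality_left_symm _ _).trans <|
      (congrArg _ (eU _)).trans (Category.comp_id _)
  · intro c
    apply Over.OverMorphism.ext
    exact (key c).1
  · intro c m hm₁ _
    apply Over.OverMorphism.ext
    have hnat := (Over.forgetAdjStar A).homEquiv_naturality_left_symm m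
      ((Over.forgetAdjStar A).unit.app (Over.mk g))
    calc (Over.forget A).map m
        = (Over.forget A).map m ≫ 𝟙 _ := (Category.comp_id _).symm
      _ = (Over.forget A).map m ≫ ((Over.forgetAdjStar A).homEquiv (Over.mk g) B).symm
            ((Over.forgetAdjStar A).unit.app (Over.mk g)) := congrArg _ (eU (Over.mk g)).symm
      _ = ((Over.forgetAdjStar A).homEquiv c.pt B).symm
            (m ≫ (Over.forgetAdjStar A).unit.app (Over.mk g)) := hnat.symm
      _ = ((Over.forgetAdjStar A).homEquiv c.pt B).symm c.fst := congrArg _ hm₁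

/-- The tautological section `s = α(η_{𝟙_A}) ≫ e_B⁻¹_A : T → φ^*A` of the global clause (`T := α(A = A)`,
terminal in `B(𝒢′)`), as in `TieLabels`. [cite: MochizukiSemiAnbd2006, Def. 2.2(i) p.23] -/
noncomputable abbrev globalSection : α.obj (Over.mk (𝟙 A)) ⟶ φ.pullbackFunctor.obj A :=
  α.map ((Over.forgetAdjStar A).unit.app (Over.mk (𝟙 A))) ≫ eB.inv.app A

omit [α.IsEquivalence] in
/-- The square `α(B → A) → φ^*B → φ^*A` = `α(B → A) → T → φ^*A` commutes.
[cite: MochizukiSemiAnbd2006, Def. 2.2(i) p.23] -/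
theorem globalSquare_comm :
    (α.map ((Over.forgetAdjStar A).unit.app (Over.mk g)) ≫ eB.inv.app B) ≫ φ.pullbackFunctor.map g =
      α.map (overToId g) ≫ φ.globalSection α eB := by
  have hn : eB.inv.app B ≫ φ.pullbackFunctor.map g =
      α.map ((Over.forget A ⋙ Over.star A).map (overToId g)) ≫ eB.inv.app A :=
    (eB.inv.naturality g).symm
  have hsq := congrArg α.map (overSquare_comm g)
  rw [α.map_comp, α.map_comp] at hsq
  exact (Category.assoc _ _ _).trans <| (congrArg _ hn).trans <|
    (Category.assoc _ _ _).symm.trans <| (congrArg (· ≫ eB.inv.app A) hsq).trans (Category.assoc _ _ _)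

/-- **`α(B → A)` is a pullback `φ^*B ×_{φ^*A} T` along the tautological section** (`α` preserves the
pullback square of `overSquareIsLimit`; then transport along `e_B`).
[cite: MochizukiSemiAnbd2006, Def. 2.2(i) p.23] -/
noncomputable def globalSquareIsLimit :
    IsLimit (PullbackCone.mk (α.map ((Over.forgetAdjStar A).unit.app (Over.mk g)) ≫ eB.inv.app B)
      (α.map (overToId g)) (φ.globalSquare_comm α eB g)) := by
  have h3 := isLimitPullbackConeMapOfIsLimit α (overSquare_comm g) (overSquareIsLimit g)
  have hn : ∀ c : PullbackCone (φ.pullbackFunctor.map g) (φ.globalSection α eB),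
      (c.fst ≫ eB.hom.app B) ≫ α.map ((Over.forget A ⋙ Over.star A).map (overToId g)) =
        c.snd ≫ α.map ((Over.forgetAdjStar A).unit.app (Over.mk (𝟙 A))) := by
    intro c
    have hnat : eB.hom.app B ≫ α.map ((Over.forget A ⋙ Over.star A).map (overToId g)) =
        φ.pullbackFunctor.map g ≫ eB.hom.app A :=
      (eB.hom.naturality g).symm
    have hc := c.condition
    have hid : eB.inv.app A ≫ eB.hom.app A = 𝟙 _ := eB.inv_hom_id_app A
    have hlast : φ.globalSection α eB ≫ eB.hom.app A =
        α.map ((Over.forgetAdjStar A).unit.app (Over.mk (𝟙 A))) :=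
      (Category.assoc _ _ _).trans <| (congrArg _ hid).trans (Category.comp_id _)
    calc (c.fst ≫ eB.hom.app B) ≫ α.map ((Over.forget A ⋙ Over.star A).map (overToId g))
        = c.fst ≫ (eB.hom.app B ≫ α.map ((Over.forget A ⋙ Over.star A).map (overToId g))) :=
          Category.assoc _ _ _
      _ = c.fst ≫ (φ.pullbackFunctor.map g ≫ eB.hom.app A) := congrArg _ hnat
      _ = (c.fst ≫ φ.pullbackFunctor.map g) ≫ eB.hom.app A := (Category.assoc _ _ _).symm
      _ = (c.snd ≫ φ.globalSection α eB) ≫ eB.hom.app A := congrArg (· ≫ _) hc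
      _ = c.snd ≫ (φ.globalSection α eB ≫ eB.hom.app A) := Category.assoc _ _ _
      _ = c.snd ≫ α.map ((Over.forgetAdjStar A).unit.app (Over.mk (𝟙 A))) := congrArg _ hlast
  refine PullbackCone.IsLimit.mk _
    (fun c => PullbackCone.IsLimit.lift h3 (c.fst ≫ eB.hom.app B) c.snd (hn c)) ?_ ?_ ?_
  · intro c
    have hl := PullbackCone.IsLimit.lift_fst h3 (c.fst ≫ eB.hom.app B) c.snd (hn c)
    have hid : eB.hom.app B ≫ eB.inv.app B = 𝟙 _ := eB.hom_inv_id_app B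
    calc PullbackCone.IsLimit.lift h3 (c.fst ≫ eB.hom.app B) c.snd (hn c) ≫
          (α.map ((Over.forgetAdjStar A).unit.app (Over.mk g)) ≫ eB.inv.app B)
        = (PullbackCone.IsLimit.lift h3 (c.fst ≫ eB.hom.app B) c.snd (hn c) ≫
            α.map ((Over.forgetAdjStar A).unit.app (Over.mk g))) ≫ eB.inv.app B :=
          (Category.assoc _ _ _).symm
      _ = (c.fst ≫ eB.hom.app B) ≫ eB.inv.app B := congrArg (· ≫ _) hl
      _ = c.fst ≫ (eB.hom.app B ≫ eB.inv.app B) := Category.assoc _ _ _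
      _ = c.fst := (congrArg _ hid).trans (Category.comp_id _)
  · intro c
    exact PullbackCone.IsLimit.lift_snd h3 (c.fst ≫ eB.hom.app B) c.snd (hn c)
  · intro c m hm₁ hm₂
    apply PullbackCone.IsLimit.hom_ext h3
    · have hl := PullbackCone.IsLimit.lift_fst h3 (c.fst ≫ eB.hom.app B) c.snd (hn c)
      have hid : eB.inv.app B ≫ eB.hom.app B = 𝟙 _ := eB.inv_hom_id_app B
      have hm : m ≫ α.map ((Over.forgetAdjStar A).unit.app (Over.mk g)) = c.fst ≫ eB.hom.app B :=
        calc m ≫ α.map ((Over.forgetAdjStar A).unit.app (Over.mk g))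
            = m ≫ (α.map ((Over.forgetAdjStar A).unit.app (Over.mk g)) ≫
                (eB.inv.app B ≫ eB.hom.app B)) :=
              (congrArg _ ((congrArg _ hid).trans (Category.comp_id _))).symm
          _ = (m ≫ (α.map ((Over.forgetAdjStar A).unit.app (Over.mk g)) ≫ eB.inv.app B)) ≫
                eB.hom.app B := by
              simp only [Category.assoc]
          _ = c.fst ≫ eB.hom.app B := congrArg (· ≫ _) hm₁
      exact hm.trans hl.symm
    · exact hm₂.trans (PullbackCone.IsLimit.lift_snd h3 (c.fst ≫ eB.hom.app B) c.snd (hn c)).symm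

/-- **The global equivalence is computed by the section pull-back**: `α(B → A) ≅ sectionPullback s (B → A)`
for the tautological section `s`. [cite: MochizukiSemiAnbd2006, Def. 2.2(i) p.23] -/
noncomputable def isoSectionPullback :
    α.obj (Over.mk g) ≅ φ.sectionPullback (φ.globalSection α eB) g :=
  IsLimit.conePointUniqueUpToIso (φ.globalSquareIsLimit α eB g)
    (φ.sectionPullbackIsLimit (φ.globalSection α eB) g)

/-- **Invisible regluings give isomorphic objects over `A`.**  If `θ` is a family of twists of `B` over `A`
(`θ_b ≫ g_e = g_e`) whose pull-backs are the identity on the edge cells of the section pull-back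
(`fst ≫ θ^φ_{b′} = fst`, the hypothesis of `Hom.sectionPullback_reglue`), then `(B → A) ≅ (B^θ → A)` in
`B(𝒢)_{/A}`. [cite: MochizukiSemiAnbd2006, Cor. 2.7(i) p.30] -/
noncomputable def overIsoOfInvisibleReglue
    (θ : ∀ b : 𝒢.graph.Branch, B.T (𝒢.graph.edgeOf b) ≅ B.T (𝒢.graph.edgeOf b))
    (hθ : ∀ b : 𝒢.graph.Branch, (θ b).hom ≫ g.fT (𝒢.graph.edgeOf b) = g.fT (𝒢.graph.edgeOf b))
    (hinv : ∀ (b' : 𝒢'.graph.Branch) (v' : 𝒢'.graph.Vertex) (h' : 𝒢'.graph.abuts b' = some v'),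
      pullback.fst (φ.spLegT g (𝒢'.graph.edgeOf b')) ((φ.globalSection α eB).fT (𝒢'.graph.edgeOf b')) ≫
          (φ.pullbackTwist B θ b' v' h').hom =
        pullback.fst (φ.spLegT g (𝒢'.graph.edgeOf b'))
          ((φ.globalSection α eB).fT (𝒢'.graph.edgeOf b'))) :
    Over.mk g ≅ Over.mk (BObj.Hom.reglue g θ hθ) :=
  α.preimageIso
    (φ.isoSectionPullback α eB g ≪≫
      eqToIso (φ.sectionPullback_reglue (φ.globalSection α eB) g θ hθ hinv).symm ≪≫
        (φ.isoSectionPullback α eB (BObj.Hom.reglue g θ hθ)).symm)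

/-- **Invisible regluings give isomorphic objects** (`B ≅ B^θ` in `B(𝒢)`, the underlying isomorphism of
`overIsoOfInvisibleReglue`). [cite: MochizukiSemiAnbd2006, Cor. 2.7(i) p.30] -/
noncomputable def isoReglueOfInvisible
    (θ : ∀ b : 𝒢.graph.Branch, B.T (𝒢.graph.edgeOf b) ≅ B.T (𝒢.graph.edgeOf b))
    (hθ : ∀ b : 𝒢.graph.Branch, (θ b).hom ≫ g.fT (𝒢.graph.edgeOf b) = g.fT (𝒢.graph.edgeOf b))
    (hinv : ∀ (b' : 𝒢'.graph.Branch) (v' : 𝒢'.graph.Vertex) (h' : 𝒢'.graph.abuts b' = some v'),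
      pullback.fst (φ.spLegT g (𝒢'.graph.edgeOf b')) ((φ.globalSection α eB).fT (𝒢'.graph.edgeOf b')) ≫
          (φ.pullbackTwist B θ b' v' h').hom =
        pullback.fst (φ.spLegT g (𝒢'.graph.edgeOf b'))
          ((φ.globalSection α eB).fT (𝒢'.graph.edgeOf b'))) :
    B ≅ B.reglue θ :=
  (Over.forget A).mapIso (φ.overIsoOfInvisibleReglue α eB g θ hθ hinv)

end Global

end Hom

end SemiGraphOfAnabelioids

end Literature.AnabelianGeometry.SemiGraphs
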